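import Literature.Computability.AlgebraicComplexity.ChowVersusPowerSums
import Literature.Computability.AlgebraicComplexity.HwvIdealDegreeCriterion
import Literature.Computability.AlgebraicComplexity.OrbitCoordinateRingProofs
import Mathlib.Algebra.MvPolynomial.Expand
import HarnessLib

/-!
# Power sums with `k` terms have no equations of degree `≤ k`: the low-degree coordinate ring
# of `Pow^n_{m,k}` and the discharge of Dörfler–Ikenmeyer–Panova's Prop. 3.3

Topic `Literature/Computability/AlgebraicComplexity`; proofs file (theorems only, no definitions,
no named facts). Honest framing of the cell served (`pub-gct`, papers/PneNP/gct-obstructions):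
rung-1 multiplicity-obstruction search for permanent versus determinant at small `(n, m)`; no claim
about VP ≠ VNP or P ≠ NP. This file closes the MULTIPLICITY SIDE of the toy-model rung
"multiplicity obstructions are stronger than occurrence obstructions" (Dörfler–Ikenmeyer–Panova):
the named fact `DIP2020_prop_3_3` of `ChowVersusPowerSums.lean` becomes the theorem
`DIP2020_prop_3_3_holds`.

**The printed statements.**

* Dörfler–Ikenmeyer–Panova, SIAGA 4 (2020) = arXiv:1901.04576, Prop. 3.3 (p. 4): "If `λ` is an
  `m`-partition of `dn` and `k ≥ d`, then `mult_λ(ℂ[Pow_{m,k}^n]_d) = p_λ(d[n])`." — stated there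
  as "a consequence of the following result on power sums proved in [BIP19, Prop. 3.2]"; it is the
  first step (their (3.1), "`mult_λ(ℂ[Pow_{m,k}^n]_d) = p_λ(d[n])`") of the proof of the Main
  Theorem 2.3.
* Bürgisser–Ikenmeyer–Panova, J. AMS 32 (2019) = arXiv:1604.06431v3, Prop. 3.2: "If
  `f ∈ Sym^d Sym^n V` is nonzero, then `⟨f, (φ_1^n + ⋯ + φ_d^n)^d⟩ ≠ 0` for Zariski almost all
  `(φ_1, …, φ_d) ∈ (V^*)^d`. This means that `f`, viewed as a homogeneous polynomial function of
  degree `d` on `Sym^n V^*`, does not vanish on almost all power sums `φ_1^n + ⋯ + φ_d^n` with `d`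
  terms." (PROVED in the tree: `exists_aeval_formCoeff_sum_linearFormPow_ne_zero`,
  `PowerSumNonvanishing.lean`.)

**What is proved here** (tree vocabulary: `partialPowerSum k r m n _ = x₁^n + ⋯ + x_r^n` in the
`m ≥ r` variables `Fin m`, whose `GL_m`-orbit closure `Δ_n[x₁^n + ⋯ + x_r^n]` is DIP's
`Pow^n_{m,r}` for `r ≤ m`, file header of `ChowVersusPowerSums.lean`; `orbitVanishingIdeal f n =
I(GL · f) ⊆ k[Sym^n]`; `orbitMultiplicity k f n χ = mult_χ k[Δ_n[f]]`, `plethysmCoeff k σ n χ =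
mult_χ k[Sym^n (k^σ)]`, the dual-weight convention in which a weight pins the degree):

* `aeval_formCoeff_linSubst_eq_zero_of_mem_orbitVanishingIdeal` — an element of `I(GL · f)`
  vanishes on the whole endomorphism orbit `End · f` (density of `GL` in `Mat`, via the tree's
  `orbitVanishingIdeal_eq_ker_genericOrbitMap`);
* `exists_linSubst_partialPowerSum_eq` — every power sum `φ₁^n + ⋯ + φ_r^n` of `r ≤ m` linear
  forms is `A · (x₁^n + ⋯ + x_r^n)` for a matrix `A` (columns `φ_i`, then zeros);
* `eq_zero_of_mem_orbitVanishingIdeal_partialPowerSum` — **`I(Pow^n_{m,r})_d = 0` for `d ≤ r`**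
  (`n ≥ 1`, ANY field of characteristic zero): a homogeneous `Ψ ≠ 0` of degree `d ≤ r` does not
  vanish at some `∑_{i<r} a_i φ_i^n` by BIP Prop. 3.2 in coefficient form
  (`exists_aeval_formCoeff_sum_C_mul_linearFormPow_ne_zero`), so the polynomial
  `H(u) = Ψ(∑_i u_i φ_i^n)` in `u ∈ k^r` is nonzero; but `H(s_1^n, …, s_r^n) = Ψ(∑_i (s_i φ_i)^n)`
  vanishes for every `s ∈ k^r` because `∑_i (s_i φ_i)^n ∈ End · (x₁^n+⋯+x_r^n)`, i.e.
  `MvPolynomial.expand n H` vanishes identically, whence `H = 0` (`MvPolynomial.funext`,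
  `MvPolynomial.expand_eq_zero`) — a contradiction (over an algebraically closed field one may
  instead take the `a_i` to be `n`-th powers, as in the printed proof);
* `orbitMultiplicity_partialPowerSum_eq_plethysmCoeff` — hence `mult_χ k[Pow^n_{m,r}] = a_χ`
  for every weight `χ` of degree `d ≤ r` (`|χ| = -n d`), by the tree's degree criterion
  `orbitMultiplicity_eq_plethysmCoeff_of_degree_eq_zero` (Bürgisser–Ikenmeyer 2013 Prop. 3.3 /
  DIP20 (2.2) rank–nullity); partition form `orbitMultiplicity_partialPowerSum_dualOfPartition_eq`;
  occurrence form `hasHighestWeight_orbitCoordRep_partialPowerSum_iff` (in degree `≤ r` a type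
  occurs in `k[Pow^n_{m,r}]` iff it occurs in `k[Sym^n k^m]`: no occurrence obstruction against
  anything in low degree);
* `DIP2020_prop_3_3_holds : DIP2020_prop_3_3` — the discharge (over `ℂ`);
* `partialPowerSum_self_eq_psum` and the corollaries `eq_zero_of_mem_orbitVanishingIdeal_psum`,
  `orbitMultiplicity_psum_eq_plethysmCoeff`, `hasHighestWeight_orbitCoordRep_psum_iff` for
  Mathlib's full power sum `MvPolynomial.psum (Fin m) k n = x₁^n + ⋯ + x_m^n` (the form of
  `PowerSumProductObstructions.lean` and `ProductPlusPowerObstructions.lean`): no equations of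
  degree `≤ m`.

## References

* J. Dörfler, C. Ikenmeyer, G. Panova, *On geometric complexity theory: Multiplicity obstructions
  are stronger than occurrence obstructions*, SIAM J. Appl. Algebra Geom. 4 (2020) 354–376 =
  ICALP 2019 = arXiv:1901.04576, §3, Prop. 3.3 and (3.1). [DorflerIkenmeyerPanova2020]
* P. Bürgisser, C. Ikenmeyer, G. Panova, *No occurrence obstructions in geometric complexity
  theory*, J. AMS 32 (2019) 163–193 = arXiv:1604.06431v3, §3(a) Prop. 3.2.
  [BurgisserIkenmeyerPanovaJAMS2019]
* P. Bürgisser, C. Ikenmeyer, *Explicit lower bounds via geometric complexity theory*, STOC 2013 =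
  arXiv:1210.8368, Prop. 3.3. [BurgisserIkenmeyer2013]

## Mathlib and tree

Mathlib: `MvPolynomial.IsHomogeneous.totalDegree`, `MvPolynomial.psum`, `Fin.castLE`,
`MvPolynomial.expand`, `MvPolynomial.expand_eq_zero`, `MvPolynomial.funext`, `MvPolynomial.aeval_bind₁`.
Tree: `exists_aeval_formCoeff_sum_C_mul_linearFormPow_ne_zero` (`PowerSumNonvanishing.lean`);
`finiteDimensional_highestWeightSpace_orbitCoordRep_holds`, `finiteDimensional_highestWeightSpace_coordRep_holds`
(`SchurWeylPlethysmOrbitWeightsProofs.lean`);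
`orbitVanishingIdeal_eq_ker_genericOrbitMap`, `aeval_genericOrbitMap`
(`OrbitCoordinateRingProofs.lean`); `orbitMultiplicity_eq_plethysmCoeff_of_degree_eq_zero`
(`HwvIdealDegreeCriterion.lean`); `partialPowerSum`, `DIP2020_prop_3_3` (`ChowVersusPowerSums.lean`);
`Weight.size_dual` (`OrbitClosureWeights.lean`), `Weight.size_ofPartition_holds`
(`GLHighestWeightFacts.lean`).

Provenance: pub-gct engine cell (lit seat gen 5), LEAN-IN-TREE; TeX of arXiv:1901.04576
(`multobs.tex`, Prop. `pro:lowdegreepowersums`) read for the statement.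
-/

noncomputable section

open MvPolynomial

namespace Literature.Computability.AlgebraicComplexity

open _root_.Literature.NumberTheory.DiophantineGeometry

/-! ### 1. Elements of `I(GL · f)` vanish on the endomorphism orbit -/

section EndOrbit

variable {σ k : Type*} [Fintype σ] [DecidableEq σ] [Field k]

/-- **`I(GL · f)` vanishes on `End · f`.** Over an infinite field, a polynomial in the degree-`m`
coefficients vanishing on the orbit `GL · f` vanishes at `A · f` for every square matrix `A`,
invertible or not (`GL` is Zariski dense in `Mat`; the tree's `orbitVanishingIdeal_eq_ker_genericOrbitMap`).
Mulmuley–Sohoni 2001 §4; Bürgisser–Ikenmeyer–Panova 2019, proof of Lemma 2.2.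
[cite: BurgisserIkenmeyerPanovaJAMS2019, Lemma 2.2] -/
theorem aeval_formCoeff_linSubst_eq_zero_of_mem_orbitVanishingIdeal [Infinite k]
    {f : MvPolynomial σ k} {m : ℕ} {F : MvPolynomial (DegIdx σ m) k}
    (hF : F ∈ orbitVanishingIdeal f m) (A : Matrix σ σ k) :
    aeval (formCoeff m (linSubst σ k A f)) F = 0 := by
  rw [orbitVanishingIdeal_eq_ker_genericOrbitMap, RingHom.mem_ker] at hF
  have h := aeval_genericOrbitMap f m F A
  have hF' : aeval (fun d : DegIdx σ m => coeff d.1 (linSubst σ (MvPolynomial (σ × σ) k)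
      (Matrix.mvPolynomialX σ σ k) (map (C : k →+* MvPolynomial (σ × σ) k) f))) F = 0 := hF
  rw [hF', map_zero] at h
  exact h.symm

end EndOrbit

/-! ### 2. Power sums of `r` linear forms are endomorphism translates of `x₁^n + ⋯ + x_r^n` -/

section PowerSums

variable {k : Type*} [Field k]

/-- Every power sum `φ₁^n + ⋯ + φ_r^n` of `r ≤ m` linear forms in `m` variables is `A · (x₁^n +
⋯ + x_r^n)` for the matrix `A` whose first `r` columns are the coefficient vectors of the `φ_i`
(and whose remaining columns are zero); in particular it lies in `End · (x₁^n + ⋯ + x_r^n)`, so in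
`Pow^n_{m,r}`. DIP20 §2 ("`Pow_{m,k}^n := \overline{{ℓ₁^n + ⋯ + ℓ_k^n | ℓ_i ∈ V}}`").
[cite: DorflerIkenmeyerPanova2020, Sec. 2] -/
theorem exists_linSubst_partialPowerSum_eq {m r : ℕ} (hr : r ≤ m) (n : ℕ)
    (φ : Fin r → Fin m → k) :
    ∃ A : Matrix (Fin m) (Fin m) k,
      linSubst (Fin m) k A (partialPowerSum k r m n hr) =
        ∑ i : Fin r, (∑ x, C (φ i x) * X x : MvPolynomial (Fin m) k) ^ n := by
  classical
  refine ⟨Matrix.of fun j c => if h : (c : ℕ) < r then φ ⟨c, h⟩ j else 0, ?_⟩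
  simp only [partialPowerSum, map_sum, map_pow, linSubst_X, Matrix.of_apply, Fin.val_castLE,
    Fin.is_lt, dif_pos, Fin.eta]
  refine Finset.sum_congr rfl fun i _ => ?_
  congr 1
  refine Finset.sum_congr rfl fun x _ => ?_
  rw [smul_eq_C_mul]

/-- The full power sum is the `r = m` case: `partialPowerSum k m m n _ = x₁^n + ⋯ + x_m^n =
MvPolynomial.psum (Fin m) k n`. [folklore] -/
theorem partialPowerSum_self_eq_psum (m n : ℕ) :
    partialPowerSum k m m n le_rfl = psum (Fin m) k n := by
  simp [partialPowerSum, psum]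

/-! ### 3. `I(Pow^n_{m,r})_d = 0` for `d ≤ r` -/

/-- The polynomial `u ↦ Ψ(∑_{i<r} u_i P_i)` on `k^r` obtained from a polynomial `Ψ` in the
degree-`n` coefficients and fixed forms `P_i`: substituting for the coordinate `X_e` the linear form
`∑_i (coeff_e P_i) u_i`. Its value at `u` is `Ψ` at the coefficient vector of `∑_i u_i P_i`
(BIP §3(a): "`G(t) = F(∑_j t_j w_j)`"). [cite: BurgisserIkenmeyerPanovaJAMS2019, Lemma 3.1] -/
theorem eval_aeval_sum_X_mul_C_coeff {m n r : ℕ} (P : Fin r → MvPolynomial (Fin m) k)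
    (Ψ : MvPolynomial (DegIdx (Fin m) n) k) (u : Fin r → k) :
    eval u (aeval (fun e : DegIdx (Fin m) n => ∑ i : Fin r, X i * C (coeff e.1 (P i))) Ψ) =
      aeval (formCoeff n (∑ i : Fin r, C (u i) * P i)) Ψ := by
  have h : (aeval u).comp (aeval fun e : DegIdx (Fin m) n => ∑ i : Fin r, X i * C (coeff e.1 (P i))) =
      aeval (formCoeff n (∑ i : Fin r, C (u i) * P i)) := by
    rw [comp_aeval]
    congr 1
    funext e
    simp only [map_sum, map_mul, aeval_X, aeval_C, Algebra.algebraMap_self, RingHom.id_apply,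
      formCoeff_apply, coeff_sum, coeff_C_mul]
  have h' := congrArg (fun φ => φ Ψ) h
  simpa only [AlgHom.comp_apply, aeval_eq_eval] using h'

/-- **Power sums with `r` terms satisfy no equation of degree `≤ r`.** Let `k` be a field of
characteristic zero, `n ≥ 1`, `d ≤ r ≤ m`. Every homogeneous polynomial `Ψ` of degree `d` in the
coefficients of forms of degree `n` in `m` variables that vanishes on `GL_m · (x₁^n + ⋯ + x_r^n)`
is zero; i.e. `I(Pow^n_{m,r})_d = 0` and `k[Pow^n_{m,r}]_d = k[Sym^n k^m]_d`. Proof: if `Ψ ≠ 0`,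
BIP Prop. 3.2 in coefficient form (`exists_aeval_formCoeff_sum_C_mul_linearFormPow_ne_zero`,
`deg Ψ = d ≤ r`) gives scalars `a_i` and linear forms `φ_i` with `Ψ(∑_i a_i φ_i^n) ≠ 0`, so
`H(u) := Ψ(∑_i u_i φ_i^n)` is a nonzero polynomial on `k^r`; but `H(s_1^n, …, s_r^n) =
Ψ(∑_i (s_i φ_i)^n) = 0` for all `s`, since `∑_i (s_i φ_i)^n = A · (x₁^n + ⋯ + x_r^n)` lies in
`End · f` where `Ψ` vanishes: `expand n H` vanishes on `k^r`, hence `H = 0`. (Over `ℂ` one takes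
`a_i = s_i^n` directly, as printed.) This is the content of DIP20 Prop. 3.3 / (3.1).
[cite: DorflerIkenmeyerPanova2020, Prop. 3.3] -/
theorem eq_zero_of_mem_orbitVanishingIdeal_partialPowerSum [CharZero k]
    {m r n d : ℕ} (hr : r ≤ m) (hn : 0 < n) (hd : d ≤ r)
    {Ψ : MvPolynomial (DegIdx (Fin m) n) k}
    (hΨI : Ψ ∈ orbitVanishingIdeal (partialPowerSum k r m n hr) n) (hΨd : Ψ.IsHomogeneous d) :
    Ψ = 0 := by
  classical
  haveI : Infinite k := CharZero.infinite k
  by_contra hΨ0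
  have hdeg : Ψ.totalDegree ≤ r := (hΨd.totalDegree hΨ0).le.trans hd
  obtain ⟨a, φ, hφ⟩ := exists_aeval_formCoeff_sum_C_mul_linearFormPow_ne_zero Ψ hΨ0 hdeg
  -- the powers `P_i = φ_i^n` and the polynomial `H(u) = Ψ(∑_i u_i P_i)` on `k^r`
  set P : Fin r → MvPolynomial (Fin m) k := fun i => (∑ x, C (φ i x) * X x) ^ n with hP
  set H : MvPolynomial (Fin r) k :=
    aeval (fun e : DegIdx (Fin m) n => ∑ i : Fin r, X i * C (coeff e.1 (P i))) Ψ with hH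
  have hHa : eval a H ≠ 0 := by
    rw [hH, eval_aeval_sum_X_mul_C_coeff]
    exact hφ
  -- `H(s^n) = 0` for every `s`: the point is an endomorphism translate of `x₁^n + ⋯ + x_r^n`
  have hexp : ∀ s : Fin r → k, eval s (expand n H) = 0 := by
    intro s
    have h1 : eval s (expand n H) = eval (fun i => s i ^ n) H := by
      rw [expand, ← aeval_eq_eval, aeval_bind₁]
      simp only [map_pow, aeval_X]
      rfl
    have h2 : (∑ i : Fin r, C (s i ^ n) * P i) =
        ∑ i : Fin r, (∑ x, C ((fun i x => s i * φ i x) i x) * X x : MvPolynomial (Fin m) k) ^ n := by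
      refine Finset.sum_congr rfl fun i _ => ?_
      rw [hP]
      dsimp only
      rw [map_pow, ← mul_pow, Finset.mul_sum]
      congr 2
      funext x
      rw [map_mul, mul_assoc]
    obtain ⟨A, hA⟩ := exists_linSubst_partialPowerSum_eq (k := k) hr n (fun i x => s i * φ i x)
    rw [h1, hH, eval_aeval_sum_X_mul_C_coeff, h2, ← hA]
    exact aeval_formCoeff_linSubst_eq_zero_of_mem_orbitVanishingIdeal hΨI A
  have hexp0 : expand n H = 0 := MvPolynomial.funext fun s => by rw [hexp s, map_zero]
  exact hHa (by rw [(expand_eq_zero hn).mp hexp0, map_zero])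

/-- The full power sum `x₁^n + ⋯ + x_m^n` (Mathlib's `psum`): no equation of degree `≤ m` on its
orbit closure (`n ≥ 1`, any field of characteristic zero).
[cite: DorflerIkenmeyerPanova2020, Prop. 3.3] -/
theorem eq_zero_of_mem_orbitVanishingIdeal_psum [CharZero k] {m n d : ℕ}
    (hn : 0 < n) (hd : d ≤ m) {Ψ : MvPolynomial (DegIdx (Fin m) n) k}
    (hΨI : Ψ ∈ orbitVanishingIdeal (psum (Fin m) k n) n) (hΨd : Ψ.IsHomogeneous d) : Ψ = 0 :=
  eq_zero_of_mem_orbitVanishingIdeal_partialPowerSum (k := k) le_rfl hn hd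
    (by rwa [partialPowerSum_self_eq_psum]) hΨd

end PowerSums

/-! ### 4. Multiplicities: `mult_λ ℂ[Pow^n_{m,k}]_d = a_λ(d[n])` for `d ≤ k` (DIP20 Prop. 3.3) -/

section Multiplicities

variable {k : Type} [Field k] [CharZero k]

/-- **Low-degree multiplicities of `Pow^n_{m,r}` are plethysm coefficients** (weight form). For
`n ≥ 1`, `d ≤ r ≤ m` and every weight `χ` of `GL_m` of degree `d` (`|χ| = -n d`):
`mult_χ k[Δ_n[x₁^n + ⋯ + x_r^n]] = mult_χ k[Sym^n k^m] = a_χ`. From §3 and the degree criterion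
`orbitMultiplicity_eq_plethysmCoeff_of_degree_eq_zero`. [cite: DorflerIkenmeyerPanova2020, Prop. 3.3] -/
theorem orbitMultiplicity_partialPowerSum_eq_plethysmCoeff {m r n d : ℕ} (hr : r ≤ m)
    (hn : 0 < n) (hd : d ≤ r) {χ : Weight (Fin m)} (hχ : χ.size = -((n * d : ℕ) : ℤ)) :
    orbitMultiplicity k (partialPowerSum k r m n hr) n χ = plethysmCoeff k (Fin m) n χ :=
  orbitMultiplicity_eq_plethysmCoeff_of_degree_eq_zero _ hn.ne'
    (fun _ hΨI hΨd => eq_zero_of_mem_orbitVanishingIdeal_partialPowerSum hr hn hd hΨI hΨd) hχ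

/-- **DIP20 Prop. 3.3 in partition form.** For `n ≥ 1`, `d ≤ r ≤ m` and a partition `λ ⊢ d n`
with at most `m` parts: `mult_λ(k[Pow^n_{m,r}]_d) = p_λ(d[n])`, i.e.
`orbitMultiplicity k (x₁^n + ⋯ + x_r^n) n λ* = plethysmCoeffOfPartition k m n λ`.
[cite: DorflerIkenmeyerPanova2020, Prop. 3.3] -/
theorem orbitMultiplicity_partialPowerSum_dualOfPartition_eq {m r n d : ℕ} (hr : r ≤ m)
    (hn : 0 < n) (hd : d ≤ r) (lam : Nat.Partition (d * n)) (hlam : lam.parts.card ≤ m) :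
    orbitMultiplicity k (partialPowerSum k r m n hr) n (Weight.dualOfPartition m lam) =
      plethysmCoeffOfPartition k m n lam := by
  have hsize : (Weight.dualOfPartition m lam).size = -((n * d : ℕ) : ℤ) := by
    rw [Weight.dualOfPartition, Weight.size_dual, Weight.size_ofPartition_holds hlam, Nat.mul_comm]
  exact orbitMultiplicity_partialPowerSum_eq_plethysmCoeff hr hn hd hsize

/-- The same for Mathlib's full power sum `x₁^n + ⋯ + x_m^n`: for every weight `χ` of degree
`d ≤ m`, `mult_χ k[Δ_n[psum]] = a_χ`. [cite: DorflerIkenmeyerPanova2020, Prop. 3.3] -/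
theorem orbitMultiplicity_psum_eq_plethysmCoeff {m n d : ℕ} (hn : 0 < n) (hd : d ≤ m)
    {χ : Weight (Fin m)} (hχ : χ.size = -((n * d : ℕ) : ℤ)) :
    orbitMultiplicity k (psum (Fin m) k n) n χ = plethysmCoeff k (Fin m) n χ := by
  rw [← partialPowerSum_self_eq_psum]
  exact orbitMultiplicity_partialPowerSum_eq_plethysmCoeff le_rfl hn hd hχ

/-- **No occurrence gap in low degree for power sums.** For `n ≥ 1`, `d ≤ r ≤ m` and a weight `χ`
of degree `d`: `χ` occurs in `k[Pow^n_{m,r}] = k[Δ_n[x₁^n + ⋯ + x_r^n]]` iff it occurs in the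
ambient coordinate ring `k[Sym^n k^m]` (iff `a_χ ≠ 0`). In DIP's words ((3.1) with Prop. 3.3):
in degree `d ≤ k` "`mult_λ(ℂ[Pow_{m,k}^n]_d) = p_λ(d[n])`", so in particular every `λ` with
`p_λ(d[n]) > 0` occurs. [cite: DorflerIkenmeyerPanova2020, Prop. 3.3] -/
theorem hasHighestWeight_orbitCoordRep_partialPowerSum_iff {m r n d : ℕ} (hr : r ≤ m)
    (hn : 0 < n) (hd : d ≤ r) {χ : Weight (Fin m)} (hχ : χ.size = -((n * d : ℕ) : ℤ)) :
    HasHighestWeight (orbitCoordRep (partialPowerSum k r m n hr) n) χ ↔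
      HasHighestWeight (coordRep (Fin m) k n) χ := by
  haveI : Infinite k := CharZero.infinite k
  haveI := finiteDimensional_highestWeightSpace_orbitCoordRep_holds (k := k)
    (partialPowerSum k r m n hr) hn.ne' χ
  haveI := finiteDimensional_highestWeightSpace_coordRep_holds (k := k) (σ := Fin m) hn.ne' χ
  unfold HasHighestWeight
  rw [ne_eq, ne_eq,
    ← Submodule.finrank_eq_zero (S := highestWeightSpace (orbitCoordRep (partialPowerSum k r m n hr) n) χ),
    ← Submodule.finrank_eq_zero (S := highestWeightSpace (coordRep (Fin m) k n) χ)]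
  change ¬ orbitMultiplicity k (partialPowerSum k r m n hr) n χ = 0 ↔ ¬ plethysmCoeff k (Fin m) n χ = 0
  rw [orbitMultiplicity_partialPowerSum_eq_plethysmCoeff hr hn hd hχ]

/-- The same for Mathlib's full power sum: in degree `d ≤ m` a weight occurs in
`k[Δ_n[x₁^n + ⋯ + x_m^n]]` iff it occurs in `k[Sym^n k^m]`. [cite: DorflerIkenmeyerPanova2020, Prop. 3.3] -/
theorem hasHighestWeight_orbitCoordRep_psum_iff {m n d : ℕ} (hn : 0 < n) (hd : d ≤ m)
    {χ : Weight (Fin m)} (hχ : χ.size = -((n * d : ℕ) : ℤ)) :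
    HasHighestWeight (orbitCoordRep (psum (Fin m) k n) n) χ ↔
      HasHighestWeight (coordRep (Fin m) k n) χ := by
  rw [← partialPowerSum_self_eq_psum]
  exact hasHighestWeight_orbitCoordRep_partialPowerSum_iff le_rfl hn hd hχ

/-- **Discharge of the named fact `DIP2020_prop_3_3`** (Dörfler–Ikenmeyer–Panova 2020, Prop. 3.3,
from BIP 2019 Prop. 3.2): "If `λ` is an `m`-partition of `dn` and `k ≥ d`, then
`mult_λ(ℂ[Pow_{m,k}^n]_d) = p_λ(d[n])`", in the orbit-closure range `d ≤ k ≤ m`, `n ≥ 1` of the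
fact. [cite: DorflerIkenmeyerPanova2020, Prop. 3.3] -/
theorem DIP2020_prop_3_3_holds : DIP2020_prop_3_3 :=
  fun _ _ _ _ hr hn hdr lam hlam =>
    orbitMultiplicity_partialPowerSum_dualOfPartition_eq hr hn hdr lam hlam

/-- With the discharge, DIP's obstruction `λ = (n²-2, n, 2)` is a vanishing ideal occurrence
obstruction outright under Thm. 2.3 (1) alone (the tree's
`dip2020_isVanishingIdealOccurrenceObstructionAt` fed with `DIP2020_prop_3_3_holds`).
[cite: DorflerIkenmeyerPanova2020, Thm. 2.3] -/
theorem dip2020_isVanishingIdealOccurrenceObstructionAt' (h : DIP2020_thm_2_3_1) {n m : ℕ}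
    (hn : 2 ≤ n) (hm : n + 1 ≤ m) :
    IsVanishingIdealOccurrenceObstructionAt
      (truncatedChowMonomial ℂ n m ((Nat.le_succ n).trans hm))
      (partialPowerSum ℂ (n + 1) m n hm) n (Weight.dualOfPartition m (dipPartition n hn)) :=
  dip2020_isVanishingIdealOccurrenceObstructionAt h DIP2020_prop_3_3_holds hn hm

end Multiplicities

end Literature.Computability.AlgebraicComplexity
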